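import Mathlib.Analysis.SpecialFunctions.Trigonometric.Complex
import Mathlib.Analysis.SpecialFunctions.Complex.Circle
import Mathlib.Analysis.Calculus.Deriv.Prod
import Mathlib.Analysis.Calculus.Deriv.Inv
import Literature.Topology.FourManifolds.GaussDiagrams
import Literature.Topology.FourManifolds.KnotGroup
import Literature.Topology.FourManifolds.TorusKnotGauss
import HarnessLib

/-!
# The regular projection of the torus knot `T(p, q)` reads `torusGauss p q`

This file (topic `Topology/FourManifolds`, companion of `TorusKnotGauss`, `GaussDiagrams`,
`KnotGroup`) realises the standard Gauss diagram `torusGauss p q` of `TorusKnotGauss` by the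
accepted torus knot `Literature.Topology.FourManifolds.torusKnot p q` (`z ↦ (zᵖ, z^q)/√2`,
`KnotGroup`) for coprime `p, q ≥ 2`:

* `TorusGauss.torusProjection p q hp hq h : (torusKnot p q hp hq h).RegularProjection` with
  `diagram := torusGauss p q`, and
* `TorusGauss.hasGaussDiagram_torusKnot : (torusKnot p q hp hq h).HasGaussDiagram (torusGauss p q)`.

Everything is proved; there are no new named facts (D-0026).

## The computation

With `Knot.planeCurve` / `Knot.heightCurve` of `GaussDiagrams` (stereographic projection from
the north pole `(0,0,0,1)`, height = third stereographic coordinate) the torus knot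
`t ↦ (cos pt, sin pt, cos qt, sin qt)/√2` projects to the radius-modulated curve
`γ(t) = (cos pt, sin pt)/(√2 - sin qt)` (`planeCurve_torusKnot`) with height
`cos qt/(√2 - sin qt)` (`heightCurve_torusKnot`): a closed `p`-braid around the origin. Its
velocity is `γ' = (q cos qt/den²)(cos pt, sin pt) + (p/den)(-sin pt, cos pt) ≠ 0`
(`hasDerivAt_planeCurve`, `deriv_planeCurve_ne_zero`). If `γ(s) = γ(t)` then comparing norms
and angles gives `p t ≡ p s (mod 2π)` and `sin qt = sin qs` (`trig_eq_of_planeCurve_eq`), whence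
either `t ≡ s (mod 2π)` or `s ≡ π/(2q) + (mp - kq)π/(pq)`, `t ≡ π/(2q) + (mp + kq)π/(pq)` with
`p ∤ mp ∓ kq` (`exists_of_planeCurve_eq`). So the crossing passages are the parameters
`θ(a) = π/(2q) + w π/(pq)`, `0 ≤ w < 2pq`, `p ∤ w`, enumerated increasingly by the marked points
`a` of `torusGauss p q` through `w(a) = p b + c + 1` for `a = pos b c` (`TorusGauss.wOf`,
`TorusGauss.theta`), and the two passages of a crossing are the pairs `{w, w'}` with
`w' ≡ w (mod 2q)`, `w' ≡ -w (mod 2p)` — exactly the chords of `torusGauss p q`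
(`wOf_partner`, `eq_partner_of_dvd`; the chord formula `β' ≡ β - 1 + (c + 1) p⁻¹ (mod q)` of
`TorusKnotGauss` enters through `TorusGauss.cast_oidx`). At an under-passage (even block)
`cos qθ = -sin((c+1)π/p) < 0` and at the over-passage of the same chord `cos qθ` is the opposite
number, so heights decide over/under as recorded (`heightCurve_theta_lt`), and the crossing
determinant is `det(γ'(over), γ'(under)) = 2pq(-cos qθ_under)/den³ > 0`
(`det_deriv_planeCurve_pos`): **all crossings are positive**. This settles, with the accepted
conventions, the chirality question flagged in the docstring of
`Rasmussen.hasRasmussenInvariant_torusKnot` (no mirror is needed).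

## Sources

* D. Rolfsen, *Knots and Links* (1976), §3.C (torus knots on the standard torus), §3.E
  (regular projections).
* J. Rasmussen, *Khovanov homology and the slice genus*, Invent. Math. 182 (2010), §5.2 (the
  positive braid diagram of `T(p, q)` with `(p - 1) q` crossings).
* Mathlib: `Real.cos_eq_cos_iff`, `Real.sin_eq_sin_iff`, `Complex.exp_mul_I` (De Moivre),
  `HasDerivAt.div`, `HasDerivAt.prodMk`, `Matrix.det_fin_two_of`, `IsCoprime.dvd_of_dvd_mul_right`.

## Design choices

* The denominator `den q t = √2 - sin qt > 0` is a named function so that the quotient rule and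
  the sign computations stay readable; all identities at chord ends are derived from the two
  integer relations `w(partner a) - w(a) ∈ 2qℤ`, `w(partner a) + w(a) ∈ 2pℕ` (`wOf_partner`).
* Hypotheses `2 ≤ p`, `2 ≤ q`, `p.Coprime q` are those of `torusKnot`; `[TorusKnotFacts]` is the
  instance binder of `torusKnot` (inhabited by `instTorusKnotFacts` of `KnotGroup`).
* Not here: the Lee-homology computation (`TorusKnotLee`) and the knot-level statement
  `hasRasmussenInvariant_torusKnot_holds` (sibling proof file of `Rasmussen`).
-/

open Function Set

noncomputable section

namespace Literature.Topology.FourManifolds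

namespace TorusGauss

variable {p q : ℕ}

/-! ## The parameter index `w` of a marked point -/

/-- The **parameter index** `w(a) = p b + c + 1` of the marked point `a = pos b c` (block `b`,
offset `c`): the crossing passages of the torus knot `t ↦ (e^{ipt}, e^{iqt})/√2` happen at the
parameters `t = π/(2q) + w π/(pq)` with `0 ≤ w < 2pq`, `p ∤ w`, and `a ↦ w(a)` enumerates these
`w` increasingly. [folklore] -/
def wOf (p q : ℕ) (a : Fin (2 * (q * (p - 1)))) : ℕ := p * (blk a).val + (off a).val + 1

/-- `w (pos b c) = p b + c + 1`. [folklore] -/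
@[simp]
theorem wOf_pos (b : Fin (2 * q)) (c : Fin (p - 1)) : wOf p q (pos p q b c) = p * b + c + 1 := by
  simp [wOf]

/-- `w < 2 p q`. [folklore] -/
theorem wOf_lt (a : Fin (2 * (q * (p - 1)))) : wOf p q a < 2 * p * q := by
  have hb := (blk a).isLt
  have hc := (off a).isLt
  rw [← pos_blk_off a, wOf_pos]
  calc p * (blk a : ℕ) + (off a : ℕ) + 1 < p * (blk a : ℕ) + p := by omega
    _ = p * ((blk a : ℕ) + 1) := by ring
    _ ≤ p * (2 * q) := Nat.mul_le_mul_left _ hb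
    _ = 2 * p * q := by ring

/-- `w ≡ c + 1 (mod p)` is not divisible by `p`. [folklore] -/
theorem wOf_mod (a : Fin (2 * (q * (p - 1)))) : wOf p q a % p = (off a).val + 1 := by
  have hc := (off a).isLt
  rw [← pos_blk_off a, wOf_pos, off_pos, add_assoc, Nat.mul_add_mod, Nat.mod_eq_of_lt (by omega)]

/-- `p ∤ w`. [folklore] -/
theorem not_dvd_wOf (a : Fin (2 * (q * (p - 1)))) : ¬ p ∣ wOf p q a := by
  rw [Nat.dvd_iff_mod_eq_zero, wOf_mod]
  omega

/-- `w` is strictly increasing in the position. [folklore] -/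
theorem wOf_strictMono : StrictMono (wOf p q) := by
  intro a a' h
  have ha := (off a).isLt
  have hva : a.val = (p - 1) * (blk a).val + (off a).val := (Nat.div_add_mod _ _).symm
  have hva' : a'.val = (p - 1) * (blk a').val + (off a').val := (Nat.div_add_mod _ _).symm
  have hlt : a.val < a'.val := h
  have hb : (blk a).val ≤ (blk a').val := Nat.div_le_div_right hlt.le
  rw [wOf, wOf]
  rcases hb.lt_or_eq with hb | hb
  · calc p * (blk a).val + (off a).val + 1 ≤ p * (blk a).val + p := by omega
      _ = p * ((blk a).val + 1) := by ring
      _ ≤ p * (blk a').val := Nat.mul_le_mul_left _ hb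
      _ < p * (blk a').val + (off a').val + 1 := by omega
  · rw [hb] at hva ⊢
    omega

/-- `w` is injective. [folklore] -/
theorem wOf_injective : Injective (wOf p q) := wOf_strictMono.injective

/-! ## The parameter indices of the two ends of a chord -/

/-- `w` of the under-passage of the chord `(β, c)`: `2pβ + c + 1`. [folklore] -/
theorem wOf_uPos (β : Fin q) (c : Fin (p - 1)) : wOf p q (uPos p q β c) = 2 * p * β + c + 1 := by
  rw [uPos, wOf_pos, ublk_val]; ring

/-- `w` of the over-passage of the chord `(β, c)`: `2pβ' + 2p - 1 - c` with `β' = oidx β c`.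
[folklore] -/
theorem wOf_oPos (β : Fin q) (c : Fin (p - 1)) :
    wOf p q (oPos p q β c) + c + 1 = 2 * p * (oidx p q β c) + 2 * p := by
  have hc := c.isLt
  rw [oPos, wOf_pos, oblk_val, Fin.val_rev]
  have : p * (2 * (oidx p q β c : ℕ) + 1) = 2 * p * (oidx p q β c : ℕ) + p := by ring
  omega

/-- **The two ends of a chord are opposite modulo `2p`**: `w(over) + w(under) ≡ 0 (mod 2p)`;
precisely `w(over) + w(under) = 2p (β' + β + 1)`. [folklore] -/
theorem wOf_oPos_add_wOf_uPos (β : Fin q) (c : Fin (p - 1)) :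
    wOf p q (oPos p q β c) + wOf p q (uPos p q β c) = 2 * p * ((oidx p q β c : ℕ) + β + 1) := by
  have h1 := wOf_oPos β c
  have h2 := wOf_uPos β c
  have : 2 * p * ((oidx p q β c : ℕ) + β + 1) = 2 * p * (oidx p q β c : ℕ) + 2 * p * β + 2 * p := by
    ring
  omega

/-- **The two ends of a chord agree modulo `2q`**: `w(over) ≡ w(under) (mod 2q)`, from
`β' ≡ β - 1 + (c + 1) p⁻¹ (mod q)` and `p p⁻¹ ≡ 1 (mod q)`. [folklore] -/
theorem wOf_oPos_sub_wOf_uPos (hpq : p.Coprime q) (β : Fin q) (c : Fin (p - 1)) :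
    ∃ J : ℤ, (wOf p q (oPos p q β c) : ℤ) - wOf p q (uPos p q β c) = 2 * q * J := by
  have hq : 0 < q := β.pos
  haveI : NeZero q := ⟨hq.ne'⟩
  -- `X = p (β' - β + 1) - (c + 1)` is divisible by `q`
  set X : ℤ := (p : ℤ) * ((oidx p q β c : ℕ) - (β : ℕ) + 1) - ((c : ℕ) + 1) with hX
  have hXq : (q : ℤ) ∣ X := by
    rw [← ZMod.intCast_zmod_eq_zero_iff_dvd]
    have h1 := cast_oidx (p := p) β c
    have h2 := natCast_mul_pinv hq hpq
    push_cast [hX]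
    rw [h1]
    linear_combination ((c : ℕ) + 1 : ZMod q) * h2
  obtain ⟨J, hJ⟩ := hXq
  refine ⟨J, ?_⟩
  have h1 := wOf_oPos β c
  have h2 := wOf_uPos β c
  have e : (wOf p q (oPos p q β c) : ℤ) - wOf p q (uPos p q β c) = 2 * X := by
    rw [hX]; zify at h1 h2; linarith
  rw [e, hJ]; ring

/-- The partner relations for an arbitrary marked point: `w(partner a) ≡ w(a) (mod 2q)` and
`w(partner a) + w(a) ≡ 0 (mod 2p)`. [folklore] -/
theorem wOf_partner (hpq : p.Coprime q) (a : Fin (2 * (q * (p - 1)))) :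
    (∃ J : ℤ, (wOf p q ((torusGauss p q).partner a) : ℤ) - wOf p q a = 2 * q * J) ∧
      ∃ M : ℕ, wOf p q ((torusGauss p q).partner a) + wOf p q a = 2 * p * M := by
  obtain ⟨β, c, rfl | rfl⟩ := eq_uPos_or_eq_oPos p q a
  · rw [partner_uPos]
    exact ⟨wOf_oPos_sub_wOf_uPos hpq β c, _, wOf_oPos_add_wOf_uPos β c⟩
  · rw [partner_oPos]
    obtain ⟨J, hJ⟩ := wOf_oPos_sub_wOf_uPos hpq β c
    refine ⟨⟨-J, by linarith⟩, (oidx p q β c : ℕ) + β + 1, ?_⟩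
    rw [add_comm]
    exact wOf_oPos_add_wOf_uPos β c

/-- Two numbers below `2pq` that agree modulo `2q` and modulo `2p` are equal (`gcd(p,q) = 1`).
[folklore] -/
theorem eq_of_dvd_of_dvd (hpq : p.Coprime q) {x y : ℕ} (hx : x < 2 * p * q) (hy : y < 2 * p * q)
    (h1 : (2 * q : ℤ) ∣ (x : ℤ) - y) (h2 : (2 * p : ℤ) ∣ (x : ℤ) - y) : x = y := by
  obtain ⟨e, he⟩ := h1
  obtain ⟨g, hg⟩ := h2
  have h3 : (p : ℤ) ∣ e * q := ⟨g, by linarith⟩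
  have hcop : IsCoprime (p : ℤ) (q : ℤ) := Nat.isCoprime_iff_coprime.2 hpq
  obtain ⟨f, hf⟩ := hcop.dvd_of_dvd_mul_right h3
  have hxy : (x : ℤ) - y = (2 * p * q : ℤ) * f := by rw [he, hf]; ring
  have hb : |(x : ℤ) - y| < 2 * p * q := by
    have hx' : (x : ℤ) < 2 * p * q := by exact_mod_cast hx
    have hy' : (y : ℤ) < 2 * p * q := by exact_mod_cast hy
    rw [abs_sub_lt_iff]; constructor <;> linarith
  have hf0 : f = 0 := by
    by_contra hne
    have h1f : (1 : ℤ) ≤ |f| := Int.one_le_abs hne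
    have hpq0 : (0 : ℤ) ≤ 2 * p * q := by positivity
    rw [hxy, abs_mul, abs_of_nonneg hpq0] at hb
    nlinarith
  rw [hf0, mul_zero, sub_eq_zero] at hxy
  exact_mod_cast hxy

/-- **The partner is determined by the two congruences**: a marked point `a'` with
`w(a') ≡ w(a) (mod 2q)` and `w(a') + w(a) ≡ 0 (mod 2p)` is the partner of `a`. [folklore] -/
theorem eq_partner_of_dvd (hpq : p.Coprime q) {a a' : Fin (2 * (q * (p - 1)))}
    (h1 : (2 * q : ℤ) ∣ (wOf p q a' : ℤ) - wOf p q a)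
    (h2 : (2 * p : ℤ) ∣ (wOf p q a' : ℤ) + wOf p q a) : a' = (torusGauss p q).partner a := by
  obtain ⟨⟨J, hJ⟩, M, hM⟩ := wOf_partner hpq a
  apply wOf_injective
  refine eq_of_dvd_of_dvd hpq (wOf_lt a') (wOf_lt _) ?_ ?_
  · have : (wOf p q a' : ℤ) - wOf p q ((torusGauss p q).partner a) =
        ((wOf p q a' : ℤ) - wOf p q a) - 2 * q * J := by linarith
    rw [this]
    exact dvd_sub h1 (Dvd.intro J rfl)
  · have : (wOf p q a' : ℤ) - wOf p q ((torusGauss p q).partner a) =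
        ((wOf p q a' : ℤ) + wOf p q a) - 2 * p * M := by zify at hM; linarith
    rw [this]
    exact dvd_sub h2 (Dvd.intro (M : ℤ) rfl)

/-- **Every admissible parameter index is realised by a marked point**: for an integer `W`
with `p ∤ W` there is a marked point `a` with `w(a) = W mod 2pq`. [folklore] -/
theorem exists_wOf_eq (hp : 2 ≤ p) (hq : 1 ≤ q) {W : ℤ} (hW : ¬ (p : ℤ) ∣ W) :
    ∃ a : Fin (2 * (q * (p - 1))), (wOf p q a : ℤ) = W % (2 * p * q) := by
  have hN : (0 : ℤ) < 2 * p * q := by positivity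
  set w : ℕ := (W % (2 * p * q)).toNat with hw
  have hw0 : (0 : ℤ) ≤ W % (2 * p * q) := Int.emod_nonneg _ hN.ne'
  have hwW : (w : ℤ) = W % (2 * p * q) := by rw [hw, Int.toNat_of_nonneg hw0]
  have hwlt : w < 2 * p * q := by
    have := Int.emod_lt_of_pos W hN
    zify; rw [hwW]; exact_mod_cast this
  have hpw : ¬ p ∣ w := by
    rintro ⟨k, hk⟩
    apply hW
    have h1 : (p : ℤ) ∣ W % (2 * p * q) := ⟨k, by rw [← hwW, hk]; push_cast; ring⟩
    have h2 : (p : ℤ) ∣ W / (2 * p * q) * (2 * p * q) := ⟨W / (2 * p * q) * (2 * q), by ring⟩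
    have := dvd_add h1 h2
    rwa [Int.emod_add_ediv_mul] at this
  have hp0 : 0 < p := by omega
  have hmod : 1 ≤ w % p := by
    rw [Nat.one_le_iff_ne_zero]
    exact fun h ↦ hpw (Nat.dvd_of_mod_eq_zero h)
  have hmodlt : w % p < p := Nat.mod_lt _ hp0
  have hdiv : w / p < 2 * q := Nat.div_lt_of_lt_mul (by linarith [Nat.mul_comm p (2 * q)])
  refine ⟨pos p q ⟨w / p, hdiv⟩ ⟨w % p - 1, by omega⟩, ?_⟩
  rw [wOf_pos, ← hwW]
  simp only
  have := Nat.div_add_mod w p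
  norm_cast
  omega

/-! ## The crossing parameters `θ` -/

/-- The parameters of the `2 q (p - 1)` passages through crossings, in increasing order:
`θ(a) = π/(2q) + w(a) π/(pq)`. [folklore] -/
def theta (p q : ℕ) (a : Fin (2 * (q * (p - 1)))) : ℝ :=
  Real.pi / (2 * q) + wOf p q a * Real.pi / (p * q)

/-- `θ` is strictly increasing. [folklore] -/
theorem theta_strictMono (hp : 2 ≤ p) (hq : 1 ≤ q) : StrictMono (theta p q) := by
  intro a b h
  have hw : (wOf p q a : ℝ) < wOf p q b := by exact_mod_cast wOf_strictMono h
  have hpq : (0 : ℝ) < p * q := by positivity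
  unfold theta
  have := Real.pi_pos
  rw [add_lt_add_iff_left, div_lt_div_iff_of_pos_right hpq]
  nlinarith

/-- All parameters lie in one period. [folklore] -/
theorem theta_lt_add_two_pi (hp : 2 ≤ p) (hq : 1 ≤ q) (a b : Fin (2 * (q * (p - 1)))) :
    theta p q a < theta p q b + 2 * Real.pi := by
  have hw : (wOf p q a : ℝ) < 2 * p * q := by exact_mod_cast wOf_lt a
  have hw' : (0 : ℝ) ≤ wOf p q b := by positivity
  have hpq : (0 : ℝ) < p * q := by positivity
  have hπ := Real.pi_pos
  unfold theta
  rw [add_assoc, add_lt_add_iff_left]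
  rw [div_add' _ _ _ hpq.ne', div_lt_div_iff_of_pos_right hpq]
  nlinarith

/-- `p θ(a) = p π/(2q) + w(a) π/q`. [folklore] -/
theorem p_mul_theta (hp : 2 ≤ p) (hq : 1 ≤ q) (a : Fin (2 * (q * (p - 1)))) :
    (p : ℝ) * theta p q a = p * Real.pi / (2 * q) + wOf p q a * Real.pi / q := by
  have hp0 : (p : ℝ) ≠ 0 := by positivity
  have hq0 : (q : ℝ) ≠ 0 := by positivity
  unfold theta
  field_simp

/-- `q θ(a) = π/2 + w(a) π/p`. [folklore] -/
theorem q_mul_theta (hp : 2 ≤ p) (hq : 1 ≤ q) (a : Fin (2 * (q * (p - 1)))) :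
    (q : ℝ) * theta p q a = Real.pi / 2 + wOf p q a * Real.pi / p := by
  have hp0 : (p : ℝ) ≠ 0 := by positivity
  have hq0 : (q : ℝ) ≠ 0 := by positivity
  unfold theta
  field_simp

/-- At the two ends of a chord, `p θ` differs by a multiple of `2π`. [folklore] -/
theorem p_mul_theta_partner (hp : 2 ≤ p) (hq : 1 ≤ q) (hpq : p.Coprime q)
    (a : Fin (2 * (q * (p - 1)))) :
    ∃ J : ℤ, (p : ℝ) * theta p q ((torusGauss p q).partner a) =
      p * theta p q a + J * (2 * Real.pi) := by
  obtain ⟨⟨J, hJ⟩, -⟩ := wOf_partner hpq a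
  refine ⟨J, ?_⟩
  have hq0 : (q : ℝ) ≠ 0 := by positivity
  rw [p_mul_theta hp hq, p_mul_theta hp hq]
  have hJ' : (wOf p q ((torusGauss p q).partner a) : ℝ) = wOf p q a + 2 * q * J := by
    have := congrArg (Int.cast : ℤ → ℝ) hJ
    push_cast at this
    linarith
  rw [hJ']
  field_simp
  ring

/-- At the two ends of a chord, `q θ` adds up to `π` modulo `2π`. [folklore] -/
theorem q_mul_theta_partner (hp : 2 ≤ p) (hq : 1 ≤ q) (hpq : p.Coprime q)
    (a : Fin (2 * (q * (p - 1)))) :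
    ∃ M : ℕ, (q : ℝ) * theta p q ((torusGauss p q).partner a) =
      Real.pi - q * theta p q a + M * (2 * Real.pi) := by
  obtain ⟨-, M, hM⟩ := wOf_partner hpq a
  refine ⟨M, ?_⟩
  have hp0 : (p : ℝ) ≠ 0 := by positivity
  rw [q_mul_theta hp hq, q_mul_theta hp hq]
  have hM' : (wOf p q ((torusGauss p q).partner a) : ℝ) = 2 * p * M - wOf p q a := by
    have := congrArg (Nat.cast : ℕ → ℝ) hM
    push_cast at this
    linarith
  rw [hM']
  field_simp
  ring

/-! ## Trigonometry at the two ends of a chord -/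

/-- At an under-passage `cos (q θ) < 0`: `q θ = π/2 + 2πβ + (c+1)π/p` with `0 < c + 1 < p`.
[folklore] -/
theorem cos_q_theta_uPos_neg (hp : 2 ≤ p) (hq : 1 ≤ q) (β : Fin q) (c : Fin (p - 1)) :
    Real.cos (q * theta p q (uPos p q β c)) < 0 := by
  have hc := c.isLt
  have hp0 : (0 : ℝ) < p := by positivity
  have hπ := Real.pi_pos
  rw [q_mul_theta hp hq, wOf_uPos]
  have e : Real.pi / 2 + ((2 * p * (β : ℕ) + c + 1 : ℕ) : ℝ) * Real.pi / p =
      ((c : ℕ) + 1) * Real.pi / p + Real.pi / 2 + (β : ℕ) * (2 * Real.pi) := by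
    field_simp
    push_cast
    ring
  rw [e, Real.cos_add_nat_mul_two_pi, Real.cos_add_pi_div_two, neg_lt_zero]
  apply Real.sin_pos_of_pos_of_lt_pi
  · positivity
  · rw [div_lt_iff₀ hp0]
    have : ((c : ℕ) + 1 : ℝ) < p := by
      have : (c : ℕ) + 1 < p := by omega
      exact_mod_cast this
    nlinarith

/-- The trigonometric functions of `p θ` and `q θ` at the partner of a marked point.
[folklore] -/
theorem trig_partner (hp : 2 ≤ p) (hq : 1 ≤ q) (hpq : p.Coprime q) (a : Fin (2 * (q * (p - 1)))) :
    Real.cos (p * theta p q ((torusGauss p q).partner a)) = Real.cos (p * theta p q a) ∧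
    Real.sin (p * theta p q ((torusGauss p q).partner a)) = Real.sin (p * theta p q a) ∧
    Real.sin (q * theta p q ((torusGauss p q).partner a)) = Real.sin (q * theta p q a) ∧
    Real.cos (q * theta p q ((torusGauss p q).partner a)) = -Real.cos (q * theta p q a) := by
  obtain ⟨J, hJ⟩ := p_mul_theta_partner hp hq hpq a
  obtain ⟨M, hM⟩ := q_mul_theta_partner hp hq hpq a
  refine ⟨?_, ?_, ?_, ?_⟩
  · rw [hJ, Real.cos_add_int_mul_two_pi]
  · rw [hJ, Real.sin_add_int_mul_two_pi]
  · rw [hM, Real.sin_add_nat_mul_two_pi, Real.sin_pi_sub]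
  · rw [hM, Real.cos_add_nat_mul_two_pi, Real.cos_pi_sub]

end TorusGauss

/-! ## The plane curve of the torus knot -/

namespace TorusGauss

open TorusGauss

/-- Local notation: `𝔼 n` is the model Euclidean space `EuclideanSpace ℝ (Fin n)`. -/
local notation "𝔼 " n:arg => EuclideanSpace ℝ (Fin n)

/-- Local notation: `𝕊 n` is the unit sphere in `EuclideanSpace ℝ (Fin (n + 1))`. -/
local notation "𝕊 " n:arg => (Metric.sphere (0 : EuclideanSpace ℝ (Fin (n + 1))) 1)

/-- The unit complex number of `circlePoint t` is `e^{it}`. [folklore] -/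
theorem circleToComplex_circlePoint (t : ℝ) :
    circleToComplex (circlePoint t) = Complex.exp (t * Complex.I) := by
  rw [circleToComplex_apply, circlePoint_apply_zero, circlePoint_apply_one, Complex.exp_mul_I,
    Complex.ofReal_cos, Complex.ofReal_sin]

/-- De Moivre: `(e^{it})ⁿ = e^{int}`. [folklore] -/
theorem circleToComplex_circlePoint_pow (t : ℝ) (n : ℕ) :
    circleToComplex (circlePoint t) ^ n = Complex.exp ((n * t : ℝ) * Complex.I) := by
  rw [circleToComplex_circlePoint, ← Complex.exp_nat_mul]
  congr 1
  push_cast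
  ring

/-- `Re (e^{it})ⁿ = cos (n t)`. [folklore] -/
theorem re_circleToComplex_circlePoint_pow (t : ℝ) (n : ℕ) :
    (circleToComplex (circlePoint t) ^ n).re = Real.cos (n * t) := by
  rw [circleToComplex_circlePoint_pow, Complex.exp_ofReal_mul_I_re]

/-- `Im (e^{it})ⁿ = sin (n t)`. [folklore] -/
theorem im_circleToComplex_circlePoint_pow (t : ℝ) (n : ℕ) :
    (circleToComplex (circlePoint t) ^ n).im = Real.sin (n * t) := by
  rw [circleToComplex_circlePoint_pow, Complex.exp_ofReal_mul_I_im]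

variable (p q : ℕ)

/-- The coordinates of the torus knot along its parametrisation:
`(cos pt, sin pt, cos qt, sin qt)/√2`. [folklore] -/
theorem torusKnotMap_circlePoint_apply (t : ℝ) (i : Fin 4) :
    ((torusKnotMap p q (circlePoint t) : 𝕊 3) : 𝔼 4) i =
      ![Real.cos (p * t) / √2, Real.sin (p * t) / √2, Real.cos (q * t) / √2,
        Real.sin (q * t) / √2] i := by
  simp only [torusKnotMap, PiLp.toLp_apply, re_circleToComplex_circlePoint_pow,
    im_circleToComplex_circlePoint_pow]

/-- The **denominator** `√2 - sin (q t) > 0` of the stereographic projection of the torus knot.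
[folklore] -/
def den (t : ℝ) : ℝ := √2 - Real.sin (q * t)

/-- The denominator is positive. [folklore] -/
theorem den_pos (t : ℝ) : 0 < den q t := by
  have h1 : Real.sin (q * t) ≤ 1 := Real.sin_le_one _
  have h2 : (1 : ℝ) < √2 := by
    rw [show (1 : ℝ) = √1 by simp]
    exact Real.sqrt_lt_sqrt (by norm_num) (by norm_num)
  unfold den
  linarith

variable [TorusKnotFacts]

/-- **The plane curve of the torus knot** (stereographic projection from the north pole):
`γ(t) = (cos pt, sin pt)/(√2 - sin qt)`, a radius-modulated curve winding `p` times around the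
origin. [folklore] -/
theorem planeCurve_torusKnot (hp : 2 ≤ p) (hq : 2 ≤ q) (h : p.Coprime q) (t : ℝ) :
    (torusKnot p q hp hq h).planeCurve t =
      (Real.cos (p * t) / den q t, Real.sin (p * t) / den q t) := by
  have hD := den_pos q t
  unfold den at hD ⊢
  have h3 : √2 - Real.sin (q * t) ≠ 0 := ne_of_gt hD
  have h4 : 1 - Real.sin (q * t) / √2 = (√2 - Real.sin (q * t)) / √2 := by field_simp
  rw [Knot.planeCurve, coe_torusKnot, planarProjection]
  simp only [torusKnotMap_circlePoint_apply]
  simp only [Matrix.cons_val_zero, Matrix.cons_val_one, Matrix.cons_val]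
  rw [h4]
  refine Prod.ext ?_ ?_ <;> simp only <;> field_simp

/-- **The height of the torus knot** over the projection plane: `cos qt/(√2 - sin qt)`.
[folklore] -/
theorem heightCurve_torusKnot (hp : 2 ≤ p) (hq : 2 ≤ q) (h : p.Coprime q) (t : ℝ) :
    (torusKnot p q hp hq h).heightCurve t = Real.cos (q * t) / den q t := by
  have hD := den_pos q t
  unfold den at hD ⊢
  have h3 : √2 - Real.sin (q * t) ≠ 0 := ne_of_gt hD
  have h4 : 1 - Real.sin (q * t) / √2 = (√2 - Real.sin (q * t)) / √2 := by field_simp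
  rw [Knot.heightCurve, coe_torusKnot, height]
  simp only [torusKnotMap_circlePoint_apply]
  simp only [Matrix.cons_val]
  rw [h4]
  field_simp

/-- The plane curve as a function. [folklore] -/
theorem planeCurve_torusKnot_eq (hp : 2 ≤ p) (hq : 2 ≤ q) (h : p.Coprime q) :
    (torusKnot p q hp hq h).planeCurve =
      fun t ↦ (Real.cos (p * t) / den q t, Real.sin (p * t) / den q t) :=
  funext (planeCurve_torusKnot p q hp hq h)

omit [TorusKnotFacts] in
/-- The derivative of the denominator: `-q cos qt`. [folklore] -/
theorem hasDerivAt_den (t : ℝ) : HasDerivAt (den q) (-(q * Real.cos (q * t))) t := by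
  unfold den
  have h := ((Real.hasDerivAt_sin (q * t)).comp t ((hasDerivAt_id t).const_mul (q : ℝ)))
  simp only [mul_one] at h
  exact (h.const_sub (√2)).congr_deriv (by ring)

/-- **The velocity of the plane curve**: `γ' = (q cos qt/den²) (cos pt, sin pt) +
(p/den) (-sin pt, cos pt)`, written out in coordinates (quotient rule). [folklore] -/
theorem hasDerivAt_planeCurve (hp : 2 ≤ p) (hq : 2 ≤ q) (h : p.Coprime q) (t : ℝ) :
    HasDerivAt (torusKnot p q hp hq h).planeCurve
      ((-(p * Real.sin (p * t)) * den q t - Real.cos (p * t) * (-(q * Real.cos (q * t)))) /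
          den q t ^ 2,
        ((p * Real.cos (p * t)) * den q t - Real.sin (p * t) * (-(q * Real.cos (q * t)))) /
          den q t ^ 2) t := by
  rw [planeCurve_torusKnot_eq]
  have hD : den q t ≠ 0 := ne_of_gt (den_pos q t)
  have hc : HasDerivAt (fun t ↦ Real.cos (p * t)) (-(p * Real.sin (p * t))) t := by
    have h := ((Real.hasDerivAt_cos (p * t)).comp t ((hasDerivAt_id t).const_mul (p : ℝ)))
    simp only [mul_one] at h
    exact h.congr_deriv (by ring)
  have hs : HasDerivAt (fun t ↦ Real.sin (p * t)) (p * Real.cos (p * t)) t := by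
    have h := ((Real.hasDerivAt_sin (p * t)).comp t ((hasDerivAt_id t).const_mul (p : ℝ)))
    simp only [mul_one] at h
    exact h.congr_deriv (by ring)
  exact (hc.div (hasDerivAt_den q t) hD).prodMk (hs.div (hasDerivAt_den q t) hD)

/-- The derivative of the plane curve, as a value of `deriv`. [folklore] -/
theorem deriv_planeCurve (hp : 2 ≤ p) (hq : 2 ≤ q) (h : p.Coprime q) (t : ℝ) :
    deriv (torusKnot p q hp hq h).planeCurve t =
      ((-(p * Real.sin (p * t)) * den q t - Real.cos (p * t) * (-(q * Real.cos (q * t)))) /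
          den q t ^ 2,
        ((p * Real.cos (p * t)) * den q t - Real.sin (p * t) * (-(q * Real.cos (q * t)))) /
          den q t ^ 2) :=
  (hasDerivAt_planeCurve p q hp hq h t).deriv

/-- **The plane curve is an immersion**: `γ'(t) ≠ 0` (its component along `(-sin pt, cos pt)`
is `p/den > 0`). [folklore] -/
theorem deriv_planeCurve_ne_zero (hp : 2 ≤ p) (hq : 2 ≤ q) (h : p.Coprime q) (t : ℝ) :
    deriv (torusKnot p q hp hq h).planeCurve t ≠ 0 := by
  rw [deriv_planeCurve]
  intro h0
  rw [Prod.ext_iff] at h0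
  obtain ⟨h1, h2⟩ := h0
  simp only [Prod.fst_zero, Prod.snd_zero] at h1 h2
  have hD := den_pos q t
  have hp0 : (0 : ℝ) < p := by positivity
  rw [div_eq_zero_iff, or_iff_left (by positivity)] at h1 h2
  have key : (p : ℝ) * den q t = 0 := by
    have c1 := Real.sin_sq_add_cos_sq (p * t)
    linear_combination (-Real.sin (p * t)) * h1 + Real.cos (p * t) * h2 - (p * den q t) * c1
  have : (0 : ℝ) < p * den q t := mul_pos hp0 hD
  linarith

/-- The torus knot misses the north pole (its last coordinate is `sin qt/√2 ≤ 1/√2 < 1`).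
[folklore] -/
theorem northPole_notMem_range_torusKnot (hp : 2 ≤ p) (hq : 2 ≤ q) (h : p.Coprime q) :
    northPole ∉ range (torusKnot p q hp hq h) := by
  rintro ⟨x, hx⟩
  obtain ⟨t, rfl⟩ := circlePoint_surjective x
  have h3 := congrArg (fun y : 𝕊 3 ↦ (y : 𝔼 4) 3) hx
  simp only [coe_torusKnot, torusKnotMap_circlePoint_apply, coe_northPole,
    PiLp.single_apply, if_true] at h3
  simp only [Matrix.cons_val] at h3
  have h1 : Real.sin (q * t) ≤ 1 := Real.sin_le_one _
  have h2 : (1 : ℝ) < √2 := by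
    rw [show (1 : ℝ) = √1 by simp]
    exact Real.sqrt_lt_sqrt (by norm_num) (by norm_num)
  rw [div_eq_one_iff_eq (by positivity)] at h3
  linarith

/-! ## The crossings: double points, heights and signs -/

/-- **The two ends of a chord project to the same point** (a double point of `γ`). [folklore] -/
theorem planeCurve_theta_overPos (hp : 2 ≤ p) (hq : 2 ≤ q) (h : p.Coprime q)
    (i : Fin (torusGauss p q).n) :
    (torusKnot p q hp hq h).planeCurve (theta p q ((torusGauss p q).overPos i)) =
      (torusKnot p q hp hq h).planeCurve (theta p q ((torusGauss p q).underPos i)) := by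
  obtain ⟨hc, hs, hsq, -⟩ := trig_partner hp (by omega) h ((torusGauss p q).underPos i)
  rw [← (torusGauss p q).partner_underPos i, planeCurve_torusKnot, planeCurve_torusKnot, den, den,
    hc, hs, hsq]

/-- **The over-passage is above the under-passage**: at an under-passage `cos (q θ) < 0`, at the
over-passage of the same chord `cos (q θ)` is the opposite (positive) number, and the
denominators agree. [folklore] -/
theorem heightCurve_theta_lt (hp : 2 ≤ p) (hq : 2 ≤ q) (h : p.Coprime q)
    (i : Fin (torusGauss p q).n) :
    (torusKnot p q hp hq h).heightCurve (theta p q ((torusGauss p q).underPos i)) <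
      (torusKnot p q hp hq h).heightCurve (theta p q ((torusGauss p q).overPos i)) := by
  obtain ⟨-, -, hsq, hcq⟩ := trig_partner hp (by omega) h ((torusGauss p q).underPos i)
  have hneg : Real.cos (q * theta p q ((torusGauss p q).underPos i)) < 0 := by
    rw [underPos_eq_uPos]
    exact cos_q_theta_uPos_neg hp (by omega) _ _
  have hD := den_pos q (theta p q ((torusGauss p q).underPos i))
  rw [← (torusGauss p q).partner_underPos i, heightCurve_torusKnot, heightCurve_torusKnot, den,
    den, hsq, hcq, div_lt_div_iff_of_pos_right (by unfold den at hD; exact hD)]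
  linarith

/-- **All crossings are positive**: the determinant `det(γ'(over), γ'(under))` equals
`p (A_over - A_under)/den³` with `A = q cos (q θ)`, positive at the over-passage and negative at
the under-passage. This settles the chirality question flagged at
`Rasmussen.hasRasmussenInvariant_torusKnot`: with the accepted conventions (`planarProjection`,
`height`, `RegularProjection.sign_eq`) the torus knot `torusKnot p q` projects to the *positive*
diagram `torusGauss p q`. [folklore] -/
theorem det_deriv_planeCurve_pos (hp : 2 ≤ p) (hq : 2 ≤ q) (h : p.Coprime q)
    (i : Fin (torusGauss p q).n) :
    0 < Matrix.det !![(deriv (torusKnot p q hp hq h).planeCurve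
        (theta p q ((torusGauss p q).overPos i))).1,
      (deriv (torusKnot p q hp hq h).planeCurve (theta p q ((torusGauss p q).overPos i))).2;
      (deriv (torusKnot p q hp hq h).planeCurve (theta p q ((torusGauss p q).underPos i))).1,
      (deriv (torusKnot p q hp hq h).planeCurve (theta p q ((torusGauss p q).underPos i))).2] := by
  obtain ⟨hc, hs, hsq, hcq⟩ := trig_partner hp (by omega) h ((torusGauss p q).underPos i)
  have hneg : Real.cos (q * theta p q ((torusGauss p q).underPos i)) < 0 := by
    rw [underPos_eq_uPos]
    exact cos_q_theta_uPos_neg hp (by omega) _ _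
  rw [← (torusGauss p q).partner_underPos i, deriv_planeCurve, deriv_planeCurve,
    Matrix.det_fin_two_of]
  simp only [den] at *
  rw [hc, hs, hsq, hcq]
  set θ := theta p q ((torusGauss p q).underPos i)
  set c := Real.cos (p * θ)
  set s := Real.sin (p * θ)
  set D := √2 - Real.sin (q * θ)
  set A := Real.cos (q * θ)
  have hD : 0 < D := den_pos q θ
  have hp0 : (0 : ℝ) < p := by positivity
  have hq0 : (0 : ℝ) < q := by positivity
  have c1 : s ^ 2 + c ^ 2 = 1 := Real.sin_sq_add_cos_sq (p * θ)
  have hD0 : D ≠ 0 := hD.ne'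
  have key : (-(p * s) * D - c * -(q * -A)) / D ^ 2 * ((p * c * D - s * -(q * A)) / D ^ 2) -
      (p * c * D - s * -(q * -A)) / D ^ 2 * ((-(p * s) * D - c * -(q * A)) / D ^ 2) =
      (2 * p * q * (-A)) * (s ^ 2 + c ^ 2) / D ^ 3 := by
    field_simp
    ring
  rw [key, c1, mul_one]
  have hA : 0 < -A := by linarith
  have : 0 < 2 * p * q * (-A) := mul_pos (mul_pos (mul_pos two_pos hp0) hq0) hA
  positivity

/-! ## The double points are the listed crossings -/

omit [TorusKnotFacts] in
/-- Two angles with the same cosine and sine differ by a multiple of `2π`. [folklore] -/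
theorem exists_int_of_cos_eq_of_sin_eq {x y : ℝ} (hc : Real.cos x = Real.cos y)
    (hs : Real.sin x = Real.sin y) : ∃ k : ℤ, y = x + k * (2 * Real.pi) := by
  rcases Real.cos_eq_cos_iff.1 hc with ⟨k, hk | hk⟩
  · exact ⟨k, by rw [hk]; ring⟩
  · have h0 : Real.sin x = 0 := by
      rw [hk, show 2 * (k : ℝ) * Real.pi - x = -x + k * (2 * Real.pi) by ring,
        Real.sin_add_int_mul_two_pi, Real.sin_neg] at hs
      linarith
    obtain ⟨n, hn⟩ := Real.sin_eq_zero_iff.1 h0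
    exact ⟨k - n, by rw [hk, ← hn]; push_cast; ring⟩

/-- If two parameters project to the same point of the plane, then `p t ≡ p s (mod 2π)` and
`sin qt = sin qs` (compare the norms `1/den`, then the angles). [folklore] -/
theorem trig_eq_of_planeCurve_eq (hp : 2 ≤ p) (hq : 2 ≤ q) (h : p.Coprime q) {s t : ℝ}
    (hst : (torusKnot p q hp hq h).planeCurve s = (torusKnot p q hp hq h).planeCurve t) :
    Real.cos (p * s) = Real.cos (p * t) ∧ Real.sin (p * s) = Real.sin (p * t) ∧
      Real.sin (q * s) = Real.sin (q * t) := by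
  rw [planeCurve_torusKnot, planeCurve_torusKnot, Prod.ext_iff] at hst
  obtain ⟨h1, h2⟩ := hst
  simp only at h1 h2
  have hDs := den_pos q s
  have hDt := den_pos q t
  rw [div_eq_div_iff hDs.ne' hDt.ne'] at h1 h2
  have c1 := Real.sin_sq_add_cos_sq (p * s)
  have c2 := Real.sin_sq_add_cos_sq (p * t)
  have hsq : den q t ^ 2 = den q s ^ 2 := by
    linear_combination (Real.cos (p * s) * den q t + Real.cos (p * t) * den q s) * h1 +
      (Real.sin (p * s) * den q t + Real.sin (p * t) * den q s) * h2 - den q t ^ 2 * c1 +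
      den q s ^ 2 * c2
  have hD : den q t = den q s := (pow_left_inj₀ hDt.le hDs.le two_ne_zero).1 hsq
  rw [hD] at h1 h2
  refine ⟨mul_right_cancel₀ hDs.ne' h1, mul_right_cancel₀ hDs.ne' h2, ?_⟩
  unfold den at hD
  linarith

/-- **The double points of the projection are exactly the crossings of `torusGauss p q`.**
If `γ(s) = γ(t)` then either `t ≡ s (mod 2π)`, or `{s, t}` is, modulo `2π`, the pair of
parameters `{θ(a), θ(partner a)}` of a chord: solving `p t ≡ p s`, `sin qt = sin qs` gives
`t - s = 2πk/p` and (unless `p ∣ k`) `q (t + s) ≡ π`, i.e. `s = π/(2q) + (mp - kq) π/(pq)`,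
`t = π/(2q) + (mp + kq) π/(pq)` with `p ∤ mp ∓ kq`, and the two indices are partners
(congruent mod `2q`, opposite mod `2p`). [folklore] -/
theorem exists_of_planeCurve_eq (hp : 2 ≤ p) (hq : 2 ≤ q) (h : p.Coprime q) {s t : ℝ}
    (hst : (torusKnot p q hp hq h).planeCurve s = (torusKnot p q hp hq h).planeCurve t) :
    (∃ k : ℤ, t = s + k * (2 * Real.pi)) ∨
      ∃ (a : Fin (2 * (q * (p - 1)))) (k l : ℤ), s + k * (2 * Real.pi) = theta p q a ∧
        t + l * (2 * Real.pi) = theta p q ((torusGauss p q).partner a) := by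
  obtain ⟨hc, hs, hsq⟩ := trig_eq_of_planeCurve_eq p q hp hq h hst
  obtain ⟨k, hk⟩ := exists_int_of_cos_eq_of_sin_eq hc hs
  have hp0 : (p : ℝ) ≠ 0 := by positivity
  have hq0 : (q : ℝ) ≠ 0 := by positivity
  have hπ : Real.pi ≠ 0 := Real.pi_ne_zero
  have hcop : IsCoprime (p : ℤ) (q : ℤ) := Nat.isCoprime_iff_coprime.2 h
  rcases Real.sin_eq_sin_iff.1 hsq with ⟨m, hm | hm⟩
  · -- `q t = 2 m π + q s` and `p t = p s + 2 k π`: `k q = m p`, so `p ∣ k`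
    left
    have e : (k : ℝ) * q = m * p := by
      have h1 : (p : ℝ) * q * (t - s) = k * q * (2 * Real.pi) := by linear_combination (q : ℝ) * hk
      have h2 : (p : ℝ) * q * (t - s) = m * p * (2 * Real.pi) := by linear_combination (p : ℝ) * hm
      have := h1.symm.trans h2
      field_simp at this
      linarith
    have e' : (k : ℤ) * q = m * p := by exact_mod_cast e
    have hdvd : (p : ℤ) ∣ k * q := ⟨m, by rw [e']; ring⟩
    obtain ⟨k', hk'⟩ := hcop.dvd_of_dvd_mul_right hdvd
    refine ⟨k', ?_⟩
    have key : (p : ℝ) * (t - s - k' * (2 * Real.pi)) = 0 := by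
      rw [hk'] at hk; push_cast at hk; linear_combination hk
    rcases mul_eq_zero.1 key with h0 | h0
    · exact absurd h0 hp0
    · linarith
  · -- `q t = (2 m + 1) π - q s` and `p t = p s + 2 k π`
    by_cases hpk : (p : ℤ) ∣ k
    · left
      obtain ⟨k', hk'⟩ := hpk
      refine ⟨k', ?_⟩
      have key : (p : ℝ) * (t - s - k' * (2 * Real.pi)) = 0 := by
        rw [hk'] at hk; push_cast at hk; linear_combination hk
      rcases mul_eq_zero.1 key with h0 | h0
      · exact absurd h0 hp0
      · linarith
    right
    -- the parameter indices of `s` and `t`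
    set Ws : ℤ := m * p - k * q with hWs
    set Wt : ℤ := m * p + k * q with hWt
    have e1 : (2 * p * q : ℝ) * s = ((2 * m + 1) * p - 2 * k * q) * Real.pi := by
      linear_combination (p : ℝ) * hm - (q : ℝ) * hk
    have hs' : s = Real.pi / (2 * q) + (Ws : ℝ) * Real.pi / (p * q) := by
      rw [hWs]; push_cast; field_simp; linear_combination e1
    have ht' : t = Real.pi / (2 * q) + (Wt : ℝ) * Real.pi / (p * q) := by
      rw [hWt]; push_cast; field_simp; linear_combination (2 * q : ℝ) * hk + e1
    have hWsp : ¬ (p : ℤ) ∣ Ws := by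
      rintro ⟨x, hx⟩
      refine hpk (hcop.dvd_of_dvd_mul_right ⟨m - x, ?_⟩)
      rw [hWs] at hx
      linarith
    have hWtp : ¬ (p : ℤ) ∣ Wt := by
      rintro ⟨x, hx⟩
      refine hpk (hcop.dvd_of_dvd_mul_right ⟨x - m, ?_⟩)
      rw [hWt] at hx
      linarith
    have hq1 : 1 ≤ q := le_trans (by norm_num) hq
    obtain ⟨a, ha⟩ := exists_wOf_eq hp hq1 hWsp
    obtain ⟨a', ha'⟩ := exists_wOf_eq hp hq1 hWtp
    set N : ℤ := 2 * p * q with hN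
    have hNr : (N : ℝ) * Real.pi / (p * q) = 2 * Real.pi := by
      rw [hN]; push_cast; field_simp
    have hWs_dec : (Ws : ℝ) = (wOf p q a : ℝ) + (Ws / N : ℤ) * (N : ℝ) := by
      have := Int.emod_add_ediv_mul Ws N
      have ha2 : ((wOf p q a : ℤ) : ℝ) = ((Ws % N : ℤ) : ℝ) := by rw [ha]
      push_cast at ha2
      rw [ha2]
      exact_mod_cast this.symm
    have hWt_dec : (Wt : ℝ) = (wOf p q a' : ℝ) + (Wt / N : ℤ) * (N : ℝ) := by
      have := Int.emod_add_ediv_mul Wt N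
      have ha2 : ((wOf p q a' : ℤ) : ℝ) = ((Wt % N : ℤ) : ℝ) := by rw [ha']
      push_cast at ha2
      rw [ha2]
      exact_mod_cast this.symm
    -- `a'` is the partner of `a`
    have hpart : a' = (torusGauss p q).partner a := by
      refine eq_partner_of_dvd h ?_ ?_
      · rw [ha, ha']
        have e2 : Wt % N - Ws % N = 2 * q * (k - (Wt / N - Ws / N) * p) := by
          have h1 := Int.emod_add_ediv_mul Ws N
          have h2 := Int.emod_add_ediv_mul Wt N
          rw [hN] at h1 h2 ⊢
          linear_combination h2 - h1
        rw [e2]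
        exact Dvd.intro _ rfl
      · rw [ha, ha']
        have e2 : Wt % N + Ws % N = 2 * p * (m - (Wt / N + Ws / N) * q) := by
          have h1 := Int.emod_add_ediv_mul Ws N
          have h2 := Int.emod_add_ediv_mul Wt N
          rw [hN] at h1 h2 ⊢
          linear_combination h2 + h1
        rw [e2]
        exact Dvd.intro _ rfl
    refine ⟨a, -(Ws / N), -(Wt / N), ?_, ?_⟩
    · rw [hs', theta, hWs_dec]
      push_cast
      rw [← hNr]
      ring
    · rw [← hpart, ht', theta, hWt_dec]
      push_cast
      rw [← hNr]
      ring

/-! ## The regular projection -/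

/-- **The regular projection of the torus knot `T(p, q)`** (`p, q ≥ 2` coprime): the
stereographic projection of `torusKnot p q = (z ↦ (zᵖ, z^q)/√2)` from the north pole is the
closed positive `p`-braid `γ(t) = (cos pt, sin pt)/(√2 - sin qt)`, regular, with `q (p - 1)`
crossings at the parameters `θ(a) = π/(2q) + w(a) π/(pq)`, all positive, reading the Gauss
diagram `torusGauss p q`. Rolfsen (1976), §3.C (torus knots), §3.E (regular projections);
Rasmussen (2010), §5.2. [cite: Rolfsen1976, §3.C] -/
def torusProjection (hp : 2 ≤ p) (hq : 2 ≤ q) (h : p.Coprime q) :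
    (torusKnot p q hp hq h).RegularProjection where
  diagram := torusGauss p q
  θ := theta p q
  strictMono := theta_strictMono hp (by omega)
  lt_add_two_pi := theta_lt_add_two_pi hp (by omega)
  northPole_notMem := northPole_notMem_range_torusKnot p q hp hq h
  deriv_ne_zero := deriv_planeCurve_ne_zero p q hp hq h
  double := planeCurve_theta_overPos p q hp hq h
  eq_or_crossing s t hst := by
    rcases exists_of_planeCurve_eq p q hp hq h hst with hk | ⟨a, k, l, hs, ht⟩
    · exact Or.inl hk
    · refine Or.inr ⟨(torusGauss p q).chordOf a, k, l, ?_⟩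
      rw [hs, ht]
      rcases (torusGauss p q).chordOf_spec a with ha | ha
      · conv_lhs => rw [← ha, GaussDiagram.partner_overPos]
      · conv_lhs => rw [← ha, GaussDiagram.partner_underPos]
        exact Set.pair_comm _ _
  heightCurve_lt := heightCurve_theta_lt p q hp hq h
  sign_eq i := by
    rw [sign_pos (det_deriv_planeCurve_pos p q hp hq h i)]
    rfl

/-- **The torus knot `T(p, q)` has the Gauss diagram `torusGauss p q`** (`p, q ≥ 2` coprime):
realisability of the standard positive braid diagram by the accepted torus knot
`Literature.Topology.FourManifolds.torusKnot p q`. Rolfsen (1976), §3.C; Rasmussen (2010), §5.2.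
[cite: Rolfsen1976, §3.C] -/
theorem hasGaussDiagram_torusKnot (hp : 2 ≤ p) (hq : 2 ≤ q) (h : p.Coprime q) :
    (torusKnot p q hp hq h).HasGaussDiagram (torusGauss p q) :=
  ⟨torusProjection p q hp hq h, rfl⟩

end TorusGauss

end Literature.Topology.FourManifolds
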